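/-
Copyright: harness M5 programme, cell ns-regularity-ideate (seat nsreg-p2, gen 15). Companion file 4 of
memo ROUND-13 («threshold functions in the axisymmetric class»), Addendum D.
-/
import Mathlib
import Summits.NavierStokesRegularity.NavierStokesRegularity.Theorems.SwirlThresholdLadderLocal
import Literature.Analysis.FluidPDE.SuitableWeakRescaling
import Literature.Analysis.FluidPDE.SereginSverakRescaledHypotheses
import Literature.Analysis.FluidPDE.SereginSverakOffAxisScaling
import Literature.Analysis.FluidPDE.LeiZhang2011ZoomIn
import HarnessLib.Audit
import HarnessLib

/-!
# Swirl-threshold ladder — parabolic zoom covariance of the local frame, and the order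
# `LocalWeiModulus → seregin2022_logSwirl_regularAtOrigin` (ROUND-13, Addendum D; companion file 4)

Companion file 2 (`…Theorems.SwirlThresholdLadderLocal`, §B′) types the LOCAL axis-modulus ladder
`LocalSwirlModulusCriterion m` — the frame of the tree fact
`Literature.Analysis.FluidPDE.seregin2022_logSwirl_regularAtOrigin` verbatim (an axisymmetric suitable
weak solution in the unit parabolic cylinder `Q = 𝒞 × ]-1,0[`, `ν = 1`, with `|Γ(t,x)| ≤ m(r)` off the
axis, is regular at the space–time origin) — with the printed rung `m(r) = C₁/ln³(e/r)` for every
`C₁` (`seregin_iff`) and the OPEN rung `m(r) = |ln r|^{-3/2}` (`LocalWeiModulus`, the local form of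
Wei's criterion).  Its `LocalSwirlModulusCriterion.mono` compares moduli pointwise on the whole radius
range `(0,1)`, which does NOT order these two rungs (`C₁/ln³(e/r) > |ln r|^{-3/2}` near `r = 1` for
large `C₁`).  This file supplies the missing structural lemma and the order:

* `localSwirlModulusCriterion_of_zoom` — **zoom covariance of the frame**: if the criterion holds for
  `m`, it holds for every `m'` with `m'(c r) ≤ m(r)` on `0 < r < 1`, for one fixed zoom factor
  `0 < c ≤ 1`.  Proof: given `v` with `|Γ_v| ≤ m'` in `Q`, the parabolic zoom
  `w(s,y) = c v(c² s, c y)` (it sees `v` only on `Q(0,c) ⊆ Q`) satisfies every hypothesis of the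
  frame — suitability, `L^∞_t L²_x`, the `L²` weak gradient, the `L^{3/2}` pressure and axial symmetry
  are covariant under the Navier–Stokes scaling, by the tree's
  `IsSuitableWeakSolutionOn.stRescale`/`.of_le`, `HasWeakSpatialGradientOn.stRescale`/`.mono`,
  `setLIntegral_preimage_comp_space_affine`, `setLIntegral_frobeniusNormSq_stRescale`,
  `SereginSverak2009.lintegral_pressure_rescale`, `isAxisymmetric_rescale`; the swirl is
  scale-invariant, `Γ_w(s,y) = Γ_v(c² s, c y)` (`swirl_smul_comp_eZ_smul`), so
  `|Γ_w(y)| ≤ m'(c r_y) ≤ m(r_y)`; and regularity of `w` at the origin pulls back to `v`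
  (`SereginSverak2009.isRegularAtOrigin_of_rescale`).
* `seregin_modulus_zoom_le_wei` — the elementary comparison: with `c = exp(-(max C₁ 1))`,
  `C₁/ln³(e/(c r)) = C₁/(1 + M + a)³ ≤ a^{-3/2}` for `a = |ln r| > 0`, `M = max C₁ 1`.
* `localWei_implies_seregin_rung`, **`localWei_implies_seregin`** — the local ladder is ORDERED:
  `LocalWeiModulus → ∀ C₁, LocalSwirlModulusCriterion (C₁/ln³(e/·))`, i.e.
  `LocalWeiModulus → seregin2022_logSwirl_regularAtOrigin`.  So the open local Wei rung is a genuine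
  strengthening of Seregin's theorem (J. Math. Fluid Mech. 24 (2022), no. 27 = arXiv:2201.00153,
  Thm. 1.2), uniformly in Seregin's constant — the local counterpart of the tree's global order
  `LeiZhang2017_logModulus_regularity_of_wei2016`.

* `powerLog_zoom_le`, `localPowerLog_of_lower_exponent`, `localWei_powerLog` — what the zoom
  absorbs: only LOWER-ORDER terms of a logarithmic modulus (`|ln(c r)| = |ln r| + |ln c|`), hence
  every constant ACROSS exponents (`0 ≤ α < β`, any `C`:
  `LocalSwirlModulusCriterion (|ln r|^{-α}) → LocalSwirlModulusCriterion (C|ln r|^{-β})`), and nothing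
  at equal exponent — consistent with the constant of Wei's criterion being a genuine parameter
  (`1`, or any `C < 2^{3/2}`, in print).

Nothing here is a statement about Navier–Stokes regularity: it is the scaling covariance of a typed
frame plus one real inequality; no open rung is claimed.
-/

namespace Summit.NavierStokesRegularity.NavierStokesRegularity.Theorems.SwirlThresholdLadderZoom

open MeasureTheory Set Filter Topology
open scoped ENNReal NNReal
open Literature.Analysis.FluidPDE
open Literature.Analysis.FluidPDE.SereginSverak2009
open Summit.NavierStokesRegularity.NavierStokesRegularity.Theorems.SwirlThresholdLadderLocal

noncomputable section

/-! ## F.1  Parabolic zoom covariance of the local axis-modulus frame -/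

/-- A scalar axisymmetric slice stays axisymmetric under the axis-centred rescaling
`y ↦ a • q (b e₃ + c y)` (scalar twin of the tree's `isAxisymmetric_rescale`). -/
theorem isAxisymmetricScalar_rescale {q : (EuclideanSpace ℝ (Fin 3)) → ℝ} (hq : IsAxisymmetricScalar q) (a b c : ℝ) :
    IsAxisymmetricScalar fun y => a • q (b • eZ + c • y) := by
  intro θ y
  simp only
  rw [← rotZ_smul_eZ_add_smul, hq θ]

/-- Times of the zoomed cylinder are times of the unit cylinder (`0 < c ≤ 1`). -/
theorem zoom_time_mem {c s : ℝ} (hc : 0 < c) (hc1 : c ≤ 1) (hs : s ∈ Ioo (-1 : ℝ) 0) :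
    0 + c ^ 2 * s ∈ Ioo (-1 : ℝ) 0 := by
  have hc2 : 0 < c ^ 2 := by positivity
  have hc21 : c ^ 2 ≤ 1 := by nlinarith
  constructor <;> nlinarith [hs.1, hs.2]

/-- Points of the zoomed spatial cylinder are points of the unit cylinder (`0 < c ≤ 1`). -/
theorem zoom_space_mem {c : ℝ} (hc : 0 < c) (hc1 : c ≤ 1) {y : (EuclideanSpace ℝ (Fin 3))} (hy : y ∈ spaceCyl 0 1) :
    (0 : ℝ) • eZ + c • y ∈ spaceCyl 0 1 := by
  have h : (0 : ℝ) • eZ + c • y ∈ spaceCyl ((0 : ℝ) • eZ) (c * 1) := by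
    rw [← preimage_spaceCyl_axisAffine hc 0 1] at hy
    exact hy
  rw [zero_smul, zero_add] at h ⊢
  rw [mem_spaceCyl] at h ⊢
  exact ⟨h.1.trans_le (by simpa using hc1), h.2.trans_le (by simpa using hc1)⟩

/-- **Zoom covariance of the local axis-modulus frame.**  If `LocalSwirlModulusCriterion m` holds,
then so does `LocalSwirlModulusCriterion m'` for every modulus `m'` with `m'(c r) ≤ m(r)` on
`0 < r < 1`, `0 < c ≤ 1` a fixed zoom factor: for a solution `v` with `|Γ_v| ≤ m'(r)` in `Q(0,1)` the
parabolic zoom `w(s,y) = c v(c² s, c y)` satisfies every hypothesis of the frame with modulus `m`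
(covariance of suitability, of the `L^∞_t L²_x`, `L²`-gradient and `L^{3/2}`-pressure classes and of
axial symmetry; scale invariance of `Γ`), and regularity of `w` at the origin is regularity of `v`. -/
theorem localSwirlModulusCriterion_of_zoom {m m' : ℝ → ℝ} (h : LocalSwirlModulusCriterion m)
    {c : ℝ} (hc : 0 < c) (hc1 : c ≤ 1)
    (hle : ∀ r : ℝ, 0 < r → r < 1 → m' (c * r) ≤ m r) :
    LocalSwirlModulusCriterion m' := by
  intro v q hsw hL2 hG hq hax haxq hΓ
  have hc2 : 0 < c ^ 2 := by positivity
  have ht₁ : -1 ≤ (0 : ℝ) - c ^ 2 := by nlinarith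
  set x₀ : (EuclideanSpace ℝ (Fin 3)) := (0 : ℝ) • eZ with hx₀
  have hx₀0 : x₀ = 0 := by rw [hx₀, zero_smul]
  -- the inclusion `Q ⊆ Φ⁻¹(Q)` and the identity `Q = Φ⁻¹(Q((0,x₀),c))`, `Q((0,x₀),c) ⊆ Q`
  have hR : parCyl (0 : ℝ × (EuclideanSpace ℝ (Fin 3))) 1 ⊆ stAffine (c ^ 2) c 0 x₀ ⁻¹' parCyl 0 1 :=
    parCyl_one_subset_preimage hc hc1 le_rfl ht₁
  have hdom : parCyl (0 : ℝ × (EuclideanSpace ℝ (Fin 3))) 1 = stAffine (c ^ 2) c 0 x₀ ⁻¹' parCyl ((0 : ℝ), x₀) c := by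
    rw [stAffine_preimage_parCyl hc, div_self hc.ne']
  have hsub : parCyl ((0 : ℝ), x₀) c ⊆ parCyl (0 : ℝ × (EuclideanSpace ℝ (Fin 3))) 1 := parCyl_shift_subset hc1 le_rfl ht₁
  apply isRegularAtOrigin_of_rescale hc
  refine h (c • stPull (c ^ 2) c 0 x₀ v) (c ^ 2 • stPull (c ^ 2) c 0 x₀ q) ?_ ?_ ?_ ?_ ?_ ?_ ?_
  · -- suitability: covariance (`stRescale`, viscosity `c·1/c = 1`, force `0`) + restriction to `Q`
    have h1 := hsw.stRescale hc hc (show c ^ 2 = c * c by ring) 0 x₀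
    have hν : c * 1 / c = 1 := by field_simp
    have hf : (c ^ 2 * c) • stPull (c ^ 2) c 0 x₀ (0 : ℝ → (EuclideanSpace ℝ (Fin 3)) → (EuclideanSpace ℝ (Fin 3))) = 0 := by
      funext s y
      simp [stPull]
    rw [hν, hf] at h1
    exact h1.of_le fun z hz => hR hz
  · -- `L^∞_t L²_x`: time quasi-invariance + space change of variables, `𝒞(0,c) ⊆ 𝒞`
    obtain ⟨C, hC⟩ := hL2
    have hC' : ∀ᵐ t ∂(volume.restrict (Ioo (0 + c ^ 2 * (-1 : ℝ)) (0 + c ^ 2 * 0))),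
        ∫⁻ x in spaceCyl 0 1, ‖v t x‖ₑ ^ 2 ≤ C :=
      ae_restrict_of_ae_restrict_of_subset (Ioo_subset_Ioo (by nlinarith) (by simp)) hC
    have hT := ae_restrict_Ioo_comp_time_affine hc2 0 (-1) 0 hC'
    set K : ℝ≥0∞ := ‖c‖ₑ ^ 2 * (ENNReal.ofReal (c ^ Module.finrank ℝ (EuclideanSpace ℝ (Fin 3)))⁻¹ * C) with hK
    have hKtop : K ≠ ∞ := by
      apply ENNReal.mul_ne_top (by simp) (ENNReal.mul_ne_top ENNReal.ofReal_ne_top (by simp))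
    refine ⟨K.toNNReal, ?_⟩
    rw [ENNReal.coe_toNNReal hKtop]
    filter_upwards [hT] with s hs
    have e1 : ∀ y : (EuclideanSpace ℝ (Fin 3)), ‖(c • stPull (c ^ 2) c 0 x₀ v) s y‖ₑ ^ 2 =
        ‖c‖ₑ ^ 2 * ‖v (0 + c ^ 2 * s) (x₀ + c • y)‖ₑ ^ 2 := by
      intro y
      rw [smul_stPull_apply, enorm_smul, mul_pow]
    simp_rw [e1]
    rw [lintegral_const_mul' _ _ (by simp), hK]
    gcongr
    have hpre : spaceCyl (0 : (EuclideanSpace ℝ (Fin 3))) 1 = (fun y : (EuclideanSpace ℝ (Fin 3)) => x₀ + c • y) ⁻¹' spaceCyl x₀ (c * 1) := by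
      rw [hx₀, preimage_spaceCyl_axisAffine hc 0 1]
    rw [hpre, setLIntegral_preimage_comp_space_affine hc x₀ (fun x => ‖v (0 + c ^ 2 * s) x‖ₑ ^ 2)
      (spaceCyl x₀ (c * 1))]
    have hsubC : spaceCyl x₀ (c * 1) ⊆ spaceCyl (0 : (EuclideanSpace ℝ (Fin 3))) 1 := by
      rw [hx₀0, mul_one]
      intro x hx
      rw [mem_spaceCyl] at hx ⊢
      exact ⟨hx.1.trans_le hc1, hx.2.trans_le hc1⟩
    gcongr 1
    exact (lintegral_mono_set hsubC).trans hs
  · -- weak gradient: covariance + restriction; `L²` finiteness by change of variables on `Q`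
    obtain ⟨G, hGw, hGfin⟩ := hG
    refine ⟨(c * c) • stPull (c ^ 2) c 0 x₀ G, ?_, ?_⟩
    · exact (hGw.stRescale c hc2 hc 0 x₀).mono fun z hz => hR hz
    · rw [hdom, setLIntegral_frobeniusNormSq_stRescale hc2 hc 0 x₀ (c * c) G]
      refine ENNReal.mul_lt_top (ENNReal.mul_lt_top ENNReal.ofReal_lt_top ENNReal.ofReal_lt_top) ?_
      exact (lintegral_mono_set hsub).trans_lt hGfin
  · -- pressure `L^{3/2}`
    exact (lintegral_pressure_rescale hc hc1 le_rfl ht₁).trans_lt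
      (ENNReal.mul_lt_top ENNReal.ofReal_lt_top hq)
  · -- axial symmetry of the velocity slices
    intro s hs
    exact isAxisymmetric_rescale (hax _ (zoom_time_mem hc hc1 hs)) c 0 c
  · -- axial symmetry of the pressure slices
    intro s hs
    exact isAxisymmetricScalar_rescale (haxq _ (zoom_time_mem hc hc1 hs)) (c ^ 2) 0 c
  · -- the swirl is scale-invariant: `Γ_w(s,y) = Γ_v(c² s, c y)`, and `m'(c r_y) ≤ m(r_y)`
    intro s hs y hy hr
    have ht := zoom_time_mem hc hc1 hs
    have hsw_eq : swirl ((c • stPull (c ^ 2) c 0 x₀ v) s) y =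
        swirl (v (0 + c ^ 2 * s)) ((0 : ℝ) • eZ + c • y) := by
      have := swirl_smul_comp_eZ_smul (v (0 + c ^ 2 * s)) c 0 hc.ne' y
      rw [div_self hc.ne', one_mul] at this
      rw [← this]
      rfl
    have hmem := zoom_space_mem hc hc1 hy
    have hrad : cylRadius ((0 : ℝ) • eZ + c • y) = c * cylRadius y := by
      rw [zero_smul, zero_add, cylRadius_smul, abs_of_pos hc]
    have hr' : 0 < cylRadius ((0 : ℝ) • eZ + c • y) := by rw [hrad]; positivity
    have hy1 : cylRadius y < 1 := by
      have := (mem_spaceCyl.1 hy).1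
      simpa using this
    rw [hsw_eq]
    calc |swirl (v (0 + c ^ 2 * s)) ((0 : ℝ) • eZ + c • y)|
        ≤ m' (cylRadius ((0 : ℝ) • eZ + c • y)) := hΓ _ ht _ hmem hr'
      _ = m' (c * cylRadius y) := by rw [hrad]
      _ ≤ m (cylRadius y) := hle _ hr hy1

/-! ## F.2  The order `LocalWeiModulus ⇒ Seregin 2022` (every constant) -/

/-- The elementary comparison: after the zoom by `c = exp(-(max C₁ 1))`, Seregin's modulus at `c r`
lies below Wei's at `r` on `0 < r < 1`: `C₁/ln³(e/(c r)) = C₁/(1 + M + a)³ ≤ a^{-3/2}` with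
`a = |ln r|`, `M = max C₁ 1` (since `C₁ a^{3/2} = C₁ a √a ≤ M a (a + 1) ≤ (1 + M + a)³`). -/
theorem seregin_modulus_zoom_le_wei {C₁ c r : ℝ} (hc : c = Real.exp (-(max C₁ 1))) (hr : 0 < r)
    (hr1 : r < 1) :
    C₁ / Real.log (Real.exp 1 / (c * r)) ^ 3 ≤ |Real.log r| ^ (-(3 / 2 : ℝ)) := by
  set M := max C₁ 1 with hM
  have hM1 : 1 ≤ M := le_max_right _ _
  have hCM : C₁ ≤ M := le_max_left _ _
  have hc0 : 0 < c := by rw [hc]; exact Real.exp_pos _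
  set a := -Real.log r with ha_def
  have hlogr : Real.log r < 0 := Real.log_neg hr hr1
  have ha : 0 < a := by rw [ha_def]; linarith
  have habs : |Real.log r| = a := by rw [abs_of_neg hlogr]
  have hlog : Real.log (Real.exp 1 / (c * r)) = 1 + M + a := by
    rw [Real.log_div (Real.exp_ne_zero 1) (mul_ne_zero hc0.ne' hr.ne'), Real.log_exp,
      Real.log_mul hc0.ne' hr.ne', hc, Real.log_exp]
    ring
  rw [hlog, habs]
  have hD : 0 < (1 + M + a) ^ 3 := by positivity
  have hP : 0 < a ^ (3 / 2 : ℝ) := Real.rpow_pos_of_pos ha _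
  by_cases hC : C₁ ≤ 0
  · have h1 : C₁ / (1 + M + a) ^ 3 ≤ 0 := div_nonpos_iff.2 (Or.inr ⟨hC, hD.le⟩)
    exact h1.trans (Real.rpow_pos_of_pos ha _).le
  · push Not at hC
    rw [Real.rpow_neg ha.le, div_le_iff₀ hD, inv_mul_eq_div, le_div_iff₀ hP]
    have hsplit : a ^ (3 / 2 : ℝ) = a * Real.sqrt a := by
      rw [show (3 / 2 : ℝ) = 1 + 1 / 2 by norm_num, Real.rpow_add ha, Real.rpow_one,
        Real.sqrt_eq_rpow]
    rw [hsplit]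
    have hsa : 0 ≤ Real.sqrt a := Real.sqrt_nonneg a
    have hsa1 : Real.sqrt a ≤ a + 1 := by
      nlinarith [Real.sq_sqrt ha.le, sq_nonneg (Real.sqrt a - 1)]
    calc C₁ * (a * Real.sqrt a) ≤ M * (a * (a + 1)) := by gcongr
      _ ≤ (1 + M + a) * ((1 + M + a) * (1 + M + a)) :=
          mul_le_mul (by linarith) (mul_le_mul (by linarith) (by linarith) (by linarith)
            (by linarith)) (by positivity) (by linarith)
      _ = (1 + M + a) ^ 3 := by ring

/-- **`LocalWeiModulus ⇒ Seregin's criterion for EVERY constant `C₁`** (zoom covariance with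
`c = exp(-(max C₁ 1))` + `seregin_modulus_zoom_le_wei`). -/
theorem localWei_implies_seregin_rung (h : LocalWeiModulus) (C₁ : ℝ) :
    LocalSwirlModulusCriterion (fun r => C₁ / Real.log (Real.exp 1 / r) ^ 3) :=
  localSwirlModulusCriterion_of_zoom h (Real.exp_pos _)
    (Real.exp_le_one_iff.2 (neg_nonpos.2 (zero_le_one.trans (le_max_right C₁ 1))))
    fun _ hr hr1 => seregin_modulus_zoom_le_wei rfl hr hr1

/-- **The local axis-modulus ladder is ordered: `LocalWeiModulus → seregin2022_logSwirl_regularAtOrigin`.**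
The open local Wei rung (exponent `3/2`, constant `1`) is a strengthening of Seregin 2022, Thm. 1.2
(exponent `3`, any constant) — the local twin of the tree's global order
`LeiZhang2017_logModulus_regularity_of_wei2016`. -/
theorem localWei_implies_seregin (h : LocalWeiModulus) : seregin2022_logSwirl_regularAtOrigin :=
  seregin_iff.2 (localWei_implies_seregin_rung h)

/-! ## F.3  What the zoom absorbs: constants across exponents (not at equal exponent) -/

/-- The elementary comparison for power-log moduli of DIFFERENT exponents `0 ≤ α < β`: after the
zoom by `c = exp(-M)`, `M = (max C 1)^{1/(β-α)} ≥ 1`, one has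
`C |ln(c r)|^{-β} = C (M + a)^{-β} ≤ a^{-α}` for `a = |ln r| > 0`
(because `C a^α ≤ M^{β-α} (M+a)^α ≤ (M+a)^β`). -/
theorem powerLog_zoom_le {α β C c r : ℝ} (hα : 0 ≤ α) (hαβ : α < β)
    (hc : c = Real.exp (-((max C 1) ^ (β - α)⁻¹))) (hr : 0 < r) (hr1 : r < 1) :
    C * |Real.log (c * r)| ^ (-β) ≤ |Real.log r| ^ (-α) := by
  set M := (max C 1) ^ (β - α)⁻¹ with hM
  have hmax1 : 1 ≤ max C 1 := le_max_right _ _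
  have hmax0 : 0 ≤ max C 1 := zero_le_one.trans hmax1
  have hβα : 0 < β - α := sub_pos.2 hαβ
  have hM1 : 1 ≤ M := Real.one_le_rpow hmax1 (inv_nonneg.2 hβα.le)
  have hM0 : 0 ≤ M := zero_le_one.trans hM1
  have hc0 : 0 < c := by rw [hc]; exact Real.exp_pos _
  set a := -Real.log r with ha_def
  have hlogr : Real.log r < 0 := Real.log_neg hr hr1
  have ha : 0 < a := by rw [ha_def]; linarith
  have habs : |Real.log r| = a := by rw [abs_of_neg hlogr]
  have hMa : 0 < M + a := by linarith
  have hlog : |Real.log (c * r)| = M + a := by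
    rw [Real.log_mul hc0.ne' hr.ne', hc, Real.log_exp, abs_of_neg (by linarith)]
    ring
  rw [hlog, habs]
  by_cases hC : C ≤ 0
  · exact (mul_nonpos_iff.2 (Or.inr ⟨hC, Real.rpow_nonneg hMa.le _⟩)).trans
      (Real.rpow_nonneg ha.le _)
  · push Not at hC
    have hCM : C ≤ M ^ (β - α) := by
      rw [hM, Real.rpow_inv_rpow hmax0 hβα.ne']
      exact le_max_left _ _
    rw [Real.rpow_neg hMa.le, Real.rpow_neg ha.le, ← div_eq_mul_inv, div_le_iff₀
      (Real.rpow_pos_of_pos hMa _), ← div_eq_inv_mul, le_div_iff₀ (Real.rpow_pos_of_pos ha _)]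
    calc C * a ^ α ≤ M ^ (β - α) * (M + a) ^ α :=
          mul_le_mul hCM (Real.rpow_le_rpow ha.le (by linarith) hα) (Real.rpow_nonneg ha.le _)
            (Real.rpow_nonneg hM0 _)
      _ ≤ (M + a) ^ (β - α) * (M + a) ^ α :=
          mul_le_mul_of_nonneg_right (Real.rpow_le_rpow hM0 (by linarith) hβα.le)
            (Real.rpow_nonneg hMa.le _)
      _ = (M + a) ^ β := by
          rw [← Real.rpow_add hMa]
          congr 1
          ring

/-- **Across exponents the zoom absorbs every constant**: for `0 ≤ α < β` and any `C`,
`LocalSwirlModulusCriterion (|ln r|^{-α}) → LocalSwirlModulusCriterion (C |ln r|^{-β})`.  (At EQUAL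
exponent it absorbs nothing: `|ln(c r)|/|ln r| → 1` as `r → 0`, so the constant of a log-modulus rung
is a genuine parameter — `1`, or any `C < 2^{3/2}`, in Wei's printed criterion.) -/
theorem localPowerLog_of_lower_exponent {α β : ℝ} (hα : 0 ≤ α) (hαβ : α < β)
    (h : LocalSwirlModulusCriterion (fun r => |Real.log r| ^ (-α))) (C : ℝ) :
    LocalSwirlModulusCriterion (fun r => C * |Real.log r| ^ (-β)) :=
  localSwirlModulusCriterion_of_zoom h (Real.exp_pos _)
    (Real.exp_le_one_iff.2 (neg_nonpos.2 (Real.rpow_nonneg (zero_le_one.trans (le_max_right C 1)) _)))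
    fun _ hr hr1 => powerLog_zoom_le hα hαβ rfl hr hr1

/-- In particular the open local Wei rung dominates every power-log rung of larger exponent with any
constant: `LocalWeiModulus → LocalSwirlModulusCriterion (C |ln r|^{-β})` for `β > 3/2`. -/
theorem localWei_powerLog (h : LocalWeiModulus) {β : ℝ} (hβ : (3 / 2 : ℝ) < β) (C : ℝ) :
    LocalSwirlModulusCriterion (fun r => C * |Real.log r| ^ (-β)) :=
  localPowerLog_of_lower_exponent (by norm_num) hβ h C

end

end Summit.NavierStokesRegularity.NavierStokesRegularity.Theorems.SwirlThresholdLadderZoom
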